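import Summits.ResolutionOfSingularities.ResolutionOfSingularities.Theorems.WeightedInvariantTieFiniteCovering
import Summits.ResolutionOfSingularities.ResolutionOfSingularities.Theorems.WeightedInvariantTieFiniteTransform
import Summits.ResolutionOfSingularities.ResolutionOfSingularities.Theorems.WeightedInvariantContactCylinderGlobalMoveChevalley
import Summits.ResolutionOfSingularities.ResolutionOfSingularities.Theorems.WeightedInvariantLexMaxCentreTransport
import HarnessLib

/-!
# (Δ10-d) FINITELY MANY TIE PRIMES OVER A HEIGHT-TWO EQUIMULTIPLE CURVE — PART 1, THE CHART: from the lex-maximal datum at `A_𝔭`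
# to a basic open `D(s) ∋ 𝔭` on which res-type-047's in-chart finiteness `TieFinite.finite_tiePrimes'` applies
# (door `HypersurfaceCentreConstruction`, stmt-ResolutionOfSingularities-19897; P3 rung inputs h7 (c8τ) / h8 (T); SPEC (Δ10) rev 3
# `L/res-L1-w43-plan-1/TieFreeNearCurve_sketch.lean` da180fe30ecb838c §(Δ10-d), steps (K2)(K3); DEAL (o52-T-b), hand res-D-brk-1)

Topic: `Summits/ResolutionOfSingularities/ResolutionOfSingularities/Theorems`. Helper for the door item
`HypersurfaceCentreConstruction` (stmt-ResolutionOfSingularities-19897, route `WeightedInvariant`), line `local-engine`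
(L W4.3), def-free.  INPUT: `A` of finite type over a perfect field, `𝔭` a prime with `A_𝔭` regular of dimension `2`, `x, g ∈ 𝔭`
and a lex-maximal admissible weighted centre germ `(x/1, g/1; r, q; r n)` of `(f/1) ⊆ A_𝔭` (Literature
`IsLexMaxWeightedCentreGerm`, Abramovich–Quek–Schober Thm 3.5), `ord_{A_𝔭} f = n ≥ 2`.  OUTPUT (`TieFinite.exists_tieChart`):
an element `s ∉ 𝔭` such that (a) on `V(x, g) ∩ D(s)` every prime `𝔮` is `⊇ 𝔭` with `A_𝔮` regular and `(x/1, g/1)` independent in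
`𝔪_𝔮/𝔪_𝔮²` (res-D-brk-1's pair clause), and (b) on the chart `A' = A_s` the COVERING TIE PRIMES of `finite_tiePrimes'` (res-type-047
p548769 / res-L1-w43-plan-1 (Δ10-c) p555504) over `P' = 𝔭 A'` with the datum `(x, g; r, q)` are FINITELY MANY.
ROUTE (= res-type-047's D2-INCHART-SPEC v3 (S4)(S5) at ring level): the chart is `s = h · s₁` with `h` from res-D-brk-1's GLOBAL MOVE
package `ContactCylinder.globalMove_chevalleyInputs'` (p554678: regularity of `A_{h h′}` and of the extended Rees algebra, (F) finite
presentation, (WP), (W) constructibility, and the pair clause) and `s₁ f ∈ 𝒥_{rn}(x, g; r, q)` from admissibility; on `A'` the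
hypotheses of `finite_tiePrimes'` are read through `A_𝔭 ≃ A'_{P'}`: `hord`, `hlex` (res-type-092's `LexMaxCentre.map_ringEquiv`), and
`hfg`/`hG`/`hcontr` from res-type-047's transform kit (`exists_transform`, `tInv_dvd_transform_iff`,
`not_mem_weightedMonomialIdeal_of_not_mem_pow`, `coeff_transform_contracted`, p550780).

[OURS · L1 W4.3 · (Δ10-d) part 1]  Replaces the role of NO printed item; NOT a statement of the manuscript
[claim: Hironaka2017, status: under-review]. AI work, weaker than expert review.  Pure commutative algebra; no named facts.

## References

* D. Abramovich, M. H. Quek, B. Schober, arXiv:2507.01232 (2025), Thm 1.3 (3), Thm 3.5. [AbramovichQuekSchober2025]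
* J. Włodarczyk, *Functorial resolution except for toroidal locus. Toroidal compactification*, Adv. Math. 407 (2022), §3.3, Def. 5.1.1. [Wlodarczyk2022]
* H. Matsumura, *Commutative Ring Theory* (1987), Thm. 4.3 (primes of a localisation). [Matsumura1987]
-/

noncomputable section

set_option linter.dupNamespace false -- mandated namespace `Summit.<Summit>.<Problem>` of this single-conjunct summit

open IsLocalRing Literature.AlgebraicGeometry.Resolution
open Summit.ResolutionOfSingularities.ResolutionOfSingularities.Theorems
open Summit.ResolutionOfSingularities.ResolutionOfSingularities.Theorems.ContactCylinder

namespace Summit.ResolutionOfSingularities.ResolutionOfSingularities.Cruxes.HypersurfaceCentreConstruction.LocalEngine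

namespace TieFinite

/-! ## Primes of `A` not containing `s` and primes of `A_s` -/

section Away

variable {A : Type} [CommRing A] (s : A)

/-- `(sⁿ) ∩ 𝔮 = ∅` for a prime `𝔮 ∌ s`. [folklore] -/
theorem disjoint_powers_of_not_mem (𝔮 : Ideal A) [𝔮.IsPrime] (hs : s ∉ 𝔮) :
    Disjoint ((Submonoid.powers s : Submonoid A) : Set A) (𝔮 : Set A) :=
  (Ideal.disjoint_powers_iff_notMem s (Ideal.IsPrime.isRadical ‹_›)).mpr hs

/-- `𝔮 A_s` is prime for a prime `𝔮 ∌ s`. [cite: Matsumura1987, Thm. 4.1] -/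
theorem isPrime_map_away (𝔮 : Ideal A) [𝔮.IsPrime] (hs : s ∉ 𝔮) :
    (𝔮.map (algebraMap A (Localization.Away s))).IsPrime :=
  IsLocalization.isPrime_of_isPrime_disjoint (Submonoid.powers s) (Localization.Away s) 𝔮 ‹_›
    (disjoint_powers_of_not_mem s 𝔮 hs)

/-- `𝔮 A_s ∩ A = 𝔮` for a prime `𝔮 ∌ s`. [cite: Matsumura1987, Thm. 4.1] -/
theorem comap_map_away (𝔮 : Ideal A) [𝔮.IsPrime] (hs : s ∉ 𝔮) :
    (𝔮.map (algebraMap A (Localization.Away s))).comap (algebraMap A (Localization.Away s)) = 𝔮 :=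
  IsLocalization.under_map_of_isPrime_disjoint (Submonoid.powers s) (Localization.Away s) ‹_›
    (disjoint_powers_of_not_mem s 𝔮 hs)

/-- `(A_s)_{𝔮 A_s}` is a localisation of `A` at `𝔮` (prime `𝔮 ∌ s`). [cite: Matsumura1987, Thm. 4.3] -/
theorem isLocalizationAtPrime_away_map (𝔮 : Ideal A) [𝔮.IsPrime] (hs : s ∉ 𝔮)
    [(𝔮.map (algebraMap A (Localization.Away s))).IsPrime] :
    IsLocalization.AtPrime (Localization.AtPrime (𝔮.map (algebraMap A (Localization.Away s)))) 𝔮 :=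
  isLocalizationAtPrime_of_eq (comap_map_away s 𝔮 hs)

/-- **The `A`-isomorphism `A_𝔮 ≃ (A_s)_{𝔮 A_s}`** (prime `𝔮 ∌ s`) and its action on `A`. [cite: Matsumura1987, Thm. 4.3] -/
theorem exists_ringEquiv_away_map (𝔮 : Ideal A) [𝔮.IsPrime] (hs : s ∉ 𝔮)
    [(𝔮.map (algebraMap A (Localization.Away s))).IsPrime] :
    ∃ e : Localization.AtPrime 𝔮 ≃+* Localization.AtPrime (𝔮.map (algebraMap A (Localization.Away s))),
      ∀ a : A, e (algebraMap A (Localization.AtPrime 𝔮) a) =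
        algebraMap (Localization.Away s) (Localization.AtPrime (𝔮.map (algebraMap A (Localization.Away s))))
          (algebraMap A (Localization.Away s) a) := by
  haveI := isLocalizationAtPrime_away_map s 𝔮 hs
  refine ⟨(IsLocalization.algEquiv 𝔮.primeCompl (Localization.AtPrime 𝔮)
    (Localization.AtPrime (𝔮.map (algebraMap A (Localization.Away s))))).toRingEquiv, fun a => ?_⟩
  rw [AlgEquiv.coe_ringEquiv, AlgEquiv.commutes,
    IsScalarTower.algebraMap_apply A (Localization.Away s) (Localization.AtPrime (𝔮.map (algebraMap A (Localization.Away s))))]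

/-- A prime of `A_s` contracts to a prime of `A` not containing `s`. [folklore] -/
theorem not_mem_comap_of_away (𝔮' : Ideal (Localization.Away s)) [𝔮'.IsPrime] :
    s ∉ 𝔮'.comap (algebraMap A (Localization.Away s)) := fun h =>
  𝔮'.ne_top_iff_one.mp (Ideal.IsPrime.ne_top ‹_›) (by
    have hu : IsUnit (algebraMap A (Localization.Away s) s) := IsLocalization.Away.algebraMap_isUnit s
    exact Ideal.eq_top_of_isUnit_mem _ (Ideal.mem_comap.mp h) hu ▸ Submodule.mem_top)

end Away


/-! ## The chart -/

section Chart

/-- **THE CHART OF THE KEY FINITENESS (Δ10-d), steps (K2)(K3).**  `A` of finite type over a perfect field `k`, `𝔭` prime with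
`A_𝔭` regular of dimension `2`, `f ∈ A` with `ord_{A_𝔭} f = n ≥ 2`, and `x, g ∈ 𝔭` carrying a lex-maximal admissible weighted centre
germ `(x/1, g/1; r, q; r n)` of `(f/1) ⊆ A_𝔭`.  Then there is `s ∉ 𝔭` such that:
(a) every prime `𝔮 ∋ x, g` with `s ∉ 𝔮` satisfies `𝔭 ≤ 𝔮`, `A_𝔮` regular, `(x/1, g/1)` independent in `𝔪_𝔮/𝔪_𝔮²`;
(b) on `A' = A_s`, with `P' = 𝔭 A'`, `f' = f/1`, `U' = (x/1, g/1)`, the set of COVERING TIE PRIMES of `finite_tiePrimes'` is finite.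
[OURS · L1 W4.3 · (Δ10-d) (K2)(K3)] -/
theorem exists_tieChart (k : Type) [Field k] [PerfectField k] (A : Type) [CommRing A] [Algebra k A] [Algebra.FiniteType k A]
    (f : A) (𝔭 : Ideal A) [𝔭.IsPrime] [IsRegularLocalRing (Localization.AtPrime 𝔭)]
    (hdim𝔭 : ringKrullDim (Localization.AtPrime 𝔭) = 2) {n : ℕ} (hn : 2 ≤ n)
    (hord : adicOrder (algebraMap A (Localization.AtPrime 𝔭) f) = (n : ℕ∞))
    (x g : A) {r q : ℕ}
    (hlex : IsLexMaxWeightedCentreGerm (Localization.AtPrime 𝔭) (Ideal.span {algebraMap A (Localization.AtPrime 𝔭) f})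
      (fun i => algebraMap A (Localization.AtPrime 𝔭) ((![x, g] : Fin 2 → A) i)) ![r, q] (r * n)) :
    ∃ s : A, s ∉ 𝔭 ∧
      (∀ (𝔮 : Ideal A) [𝔮.IsPrime], s ∉ 𝔮 → x ∈ 𝔮 → g ∈ 𝔮 →
        𝔭 ≤ 𝔮 ∧ IsRegularLocalRing (Localization.AtPrime 𝔮) ∧
        ∃ h𝔮 : ∀ i, algebraMap A (Localization.AtPrime 𝔮) ((![x, g] : Fin 2 → A) i) ∈ maximalIdeal (Localization.AtPrime 𝔮),
          LinearIndependent (ResidueField (Localization.AtPrime 𝔮)) fun i =>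
            (maximalIdeal (Localization.AtPrime 𝔮)).toCotangent ⟨algebraMap A _ ((![x, g] : Fin 2 → A) i), h𝔮 i⟩) ∧
      {𝔮 : PrimeSpectrum (Localization.Away s) | 𝔭.map (algebraMap A (Localization.Away s)) < 𝔮.asIdeal ∧
        (∀ q' : Ideal (Localization.Away s), q'.IsPrime → 𝔭.map (algebraMap A (Localization.Away s)) < q' →
          q' ≤ 𝔮.asIdeal → q' = 𝔮.asIdeal) ∧
        ∃ (_ : IsRegularLocalRing (Localization.AtPrime 𝔮.asIdeal))
        (_ : ((𝔭.map (algebraMap A (Localization.Away s))).map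
          (algebraMap (Localization.Away s) (Localization.AtPrime 𝔮.asIdeal))).IsPrime)
        (hu : ∀ i, algebraMap (Localization.Away s) (Localization.AtPrime 𝔮.asIdeal)
          ((fun i => algebraMap A (Localization.Away s) ((![x, g] : Fin 2 → A) i)) i) ∈
            maximalIdeal (Localization.AtPrime 𝔮.asIdeal)),
        LinearIndependent (ResidueField (Localization.AtPrime 𝔮.asIdeal)) (fun i =>
          (maximalIdeal (Localization.AtPrime 𝔮.asIdeal)).toCotangent
            ⟨algebraMap (Localization.Away s) _ ((fun i => algebraMap A (Localization.Away s) ((![x, g] : Fin 2 → A) i)) i),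
              hu i⟩) ∧
        Iota3.IsTiePosition (Localization.AtPrime 𝔮.asIdeal)
          (algebraMap (Localization.Away s) (Localization.AtPrime 𝔮.asIdeal) (algebraMap A (Localization.Away s) f)) ∧
        algebraMap (Localization.Away s) (Localization.AtPrime 𝔮.asIdeal) (algebraMap A (Localization.Away s) f) ∈
          maximalIdeal (Localization.AtPrime 𝔮.asIdeal) ^ n ∧
        algebraMap (Localization.Away s) (Localization.AtPrime 𝔮.asIdeal) (algebraMap A (Localization.Away s) f) ∉
          maximalIdeal (Localization.AtPrime 𝔮.asIdeal) ^ (n + 1) ∧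
        ContactCylinder.topStratumPrime Iota3.iotaOrdEps (Localization.AtPrime 𝔮.asIdeal)
          (algebraMap (Localization.Away s) (Localization.AtPrime 𝔮.asIdeal) (algebraMap A (Localization.Away s) f)) =
          (𝔭.map (algebraMap A (Localization.Away s))).map
            (algebraMap (Localization.Away s) (Localization.AtPrime 𝔮.asIdeal))}.Finite := by
  classical
  haveI : IsNoetherianRing A := Algebra.FiniteType.isNoetherianRing k A
  haveI := isDomain_of_isRegularLocalRing (Localization.AtPrime 𝔭)
  have hspan𝔭 := hlex.1
  have hpos := hlex.2.1
  have hqr := hlex.2.2.2.1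
  have hadm := hlex.2.2.2.2.2.2.1
  -- `(x, g) A_𝔭 = 𝔪_{A_𝔭}`, `x, g ∈ 𝔭`
  have hrangeU : Set.range (fun i => algebraMap A (Localization.AtPrime 𝔭) ((![x, g] : Fin 2 → A) i)) =
      {algebraMap A (Localization.AtPrime 𝔭) x, algebraMap A (Localization.AtPrime 𝔭) g} := by
    ext y; constructor
    · rintro ⟨i, rfl⟩; fin_cases i <;> simp
    · rintro (rfl | rfl)
      · exact ⟨0, rfl⟩
      · exact ⟨1, rfl⟩
  have hxg : (Ideal.span {x, g}).map (algebraMap A (Localization.AtPrime 𝔭)) = maximalIdeal (Localization.AtPrime 𝔭) := by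
    rw [← hspan𝔭, Ideal.map_span, Set.image_pair, hrangeU]
  have hmem : ∀ a : A, algebraMap A (Localization.AtPrime 𝔭) a ∈ maximalIdeal (Localization.AtPrime 𝔭) → a ∈ 𝔭 :=
    fun a ha => (IsLocalization.AtPrime.to_map_mem_maximal_iff (Localization.AtPrime 𝔭) 𝔭 a).mp ha
  have hU𝔭 : ∀ i, (![x, g] : Fin 2 → A) i ∈ 𝔭 := fun i =>
    hmem _ (hspan𝔭 ▸ Ideal.subset_span ⟨i, rfl⟩)
  have hx : x ∈ 𝔭 := hU𝔭 0
  have hg : g ∈ 𝔭 := hU𝔭 1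
  -- `s₁ ∉ 𝔭` with `s₁ f ∈ 𝒥_{rn}(x, g; r, q)` (admissibility)
  have hfadm : algebraMap A (Localization.AtPrime 𝔭) f ∈
      (weightedMonomialIdeal ![x, g] ![r, q] (r * n)).map (algebraMap A (Localization.AtPrime 𝔭)) := by
    rw [weightedMonomialIdeal_map]
    exact hadm (Ideal.mem_span_singleton_self _)
  obtain ⟨s₁, hs₁, hs₁f⟩ :=
    (IsLocalization.algebraMap_mem_map_algebraMap_iff 𝔭.primeCompl (Localization.AtPrime 𝔭) _ f).mp hfadm
  -- the global-move chart `h` (regularity, (F), (WP), (W), pair clause) and `s := h s₁`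
  obtain ⟨h, hh𝔭, -, Hpair, Hchart⟩ :=
    ContactCylinder.globalMove_chevalleyInputs' k A 𝔭 hdim𝔭 x g hxg ![r, q] hpos
  obtain ⟨-, -, hF, hWP, hWc⟩ := Hchart s₁
  set A' := Localization.Away (h * s₁) with hA'
  refine ⟨h * s₁, fun hm => (Ideal.IsPrime.mem_or_mem ‹𝔭.IsPrime› hm).elim hh𝔭 hs₁, ?_, ?_⟩
  · -- (a) the pair clause on `V(x, g) ∩ D(h s₁)`
    intro 𝔮 _ hs𝔮 hx𝔮 hg𝔮
    have hh𝔮 : h ∉ 𝔮 := fun hh => hs𝔮 (Ideal.mul_mem_right _ _ hh)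
    obtain ⟨h𝔭𝔮, hreg, -, hind⟩ := Hpair 𝔮 hh𝔮 hx𝔮 hg𝔮
    exact ⟨h𝔭𝔮, hreg, hind⟩
  -- (b) the chart `A' = A_{h s₁}`: the hypotheses of `finite_tiePrimes'`
  have hs𝔭 : h * s₁ ∉ 𝔭 := fun hm => (Ideal.IsPrime.mem_or_mem ‹𝔭.IsPrime› hm).elim hh𝔭 hs₁
  haveI hP' : (𝔭.map (algebraMap A A')).IsPrime := isPrime_map_away (h * s₁) 𝔭 hs𝔭
  obtain ⟨e, he⟩ := exists_ringEquiv_away_map (h * s₁) 𝔭 hs𝔭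
  haveI hregP' : IsRegularLocalRing (Localization.AtPrime (𝔭.map (algebraMap A A'))) := IsRegularLocalRing.of_ringEquiv e
  have hdimP' : ringKrullDim (Localization.AtPrime (𝔭.map (algebraMap A A'))) = 2 := by
    rw [← RingEquiv.ringKrullDim e]; exact hdim𝔭
  -- `f`, `x`, `g` read in `A'_{P'}`
  have hfe : algebraMap A' (Localization.AtPrime (𝔭.map (algebraMap A A'))) (algebraMap A A' f) =
      e (algebraMap A (Localization.AtPrime 𝔭) f) := (he f).symm
  have hUe : (fun i => algebraMap A' (Localization.AtPrime (𝔭.map (algebraMap A A')))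
      ((fun i => algebraMap A A' ((![x, g] : Fin 2 → A) i)) i)) =
      fun i => e (algebraMap A (Localization.AtPrime 𝔭) ((![x, g] : Fin 2 → A) i)) := by
    funext i; exact (he _).symm
  have hord' : adicOrder (algebraMap A' (Localization.AtPrime (𝔭.map (algebraMap A A'))) (algebraMap A A' f)) = (n : ℕ∞) := by
    rw [hfe, adicOrder_map_ringEquiv]; exact hord
  have hlex' : IsLexMaxWeightedCentreGerm (Localization.AtPrime (𝔭.map (algebraMap A A')))
      (Ideal.span {algebraMap A' (Localization.AtPrime (𝔭.map (algebraMap A A'))) (algebraMap A A' f)})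
      (fun i => algebraMap A' (Localization.AtPrime (𝔭.map (algebraMap A A'))) ((fun i => algebraMap A A' ((![x, g] : Fin 2 → A) i)) i))
      ![r, q] (r * n) := by
    have h1 := LexMaxCentre.map_ringEquiv hlex e
    rw [Ideal.map_span, Set.image_singleton] at h1
    rw [hfe, hUe]
    exact h1
  -- `x/1, g/1 ∈ P'`; `s₁/1` is a unit of `A'`; `f/1 ∈ 𝒥_{rn}(x/1, g/1; r, q)`
  have hUP : ∀ i, (fun i => algebraMap A A' ((![x, g] : Fin 2 → A) i)) i ∈ 𝔭.map (algebraMap A A') :=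
    fun i => Ideal.mem_map_of_mem _ (hU𝔭 i)
  have hs₁u : IsUnit (algebraMap A A' s₁) := by
    have hu : IsUnit (algebraMap A A' (h * s₁)) := IsLocalization.Away.algebraMap_isUnit (h * s₁)
    rw [map_mul] at hu
    exact isUnit_of_mul_isUnit_right hu
  have hf' : algebraMap A A' f ∈ weightedMonomialIdeal (fun i => algebraMap A A' ((![x, g] : Fin 2 → A) i)) ![r, q] (r * n) := by
    rw [← weightedMonomialIdeal_map]
    have h2 : algebraMap A A' s₁ * algebraMap A A' f ∈ (weightedMonomialIdeal ![x, g] ![r, q] (r * n)).map (algebraMap A A') := by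
      rw [← map_mul]; exact Ideal.mem_map_of_mem _ hs₁f
    exact (Ideal.unit_mul_mem_iff_mem _ hs₁u).mp h2
  -- the transform `G = f t^{rn}`
  have hrn : 0 < r * n := Nat.mul_pos (hpos 0) (by omega)
  obtain ⟨G, -, hfg⟩ := exists_transform (fun i => algebraMap A A' ((![x, g] : Fin 2 → A) i)) ![r, q] hrn hf'
  -- at `A'_{P'}`: `f ∉ 𝒥_{rn+1}` (weights `≤ r`, order `n`)
  have hu' : ∀ i, algebraMap A' (Localization.AtPrime (𝔭.map (algebraMap A A')))
      ((fun i => algebraMap A A' ((![x, g] : Fin 2 → A) i)) i) ∈ maximalIdeal (Localization.AtPrime (𝔭.map (algebraMap A A'))) :=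
    fun i => (IsLocalization.AtPrime.to_map_mem_maximal_iff (Localization.AtPrime (𝔭.map (algebraMap A A')))
      (𝔭.map (algebraMap A A')) _).mpr (hUP i)
  have hWle : ∀ i, (![r, q] : Fin 2 → ℕ) i ≤ r := by
    intro i; fin_cases i
    · exact le_rfl
    · exact hqr
  have hfn1 : algebraMap A' (Localization.AtPrime (𝔭.map (algebraMap A A'))) (algebraMap A A' f) ∉
      maximalIdeal (Localization.AtPrime (𝔭.map (algebraMap A A'))) ^ (n + 1) := (adicOrder_le_iff _ n).mp hord'.le
  have hnotmem := not_mem_weightedMonomialIdeal_of_not_mem_pow (W := ![r, q])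
    (fun i => algebraMap A' (Localization.AtPrime (𝔭.map (algebraMap A A'))) ((fun i => algebraMap A A' ((![x, g] : Fin 2 → A) i)) i))
    hu' hWle hfn1
  have hG : ¬ extReesAlgebra.tInv (weightedMonomialIdeal (fun i => algebraMap A A' ((![x, g] : Fin 2 → A) i)) ![r, q]) ∣ G := by
    intro hd
    have h1 := (tInv_dvd_transform_iff (fun i => algebraMap A A' ((![x, g] : Fin 2 → A) i)) ![r, q] hfg).mp hd
    refine hnotmem ?_
    rw [← weightedMonomialIdeal_map]
    exact Ideal.mem_map_of_mem _ h1
  have hcontr := coeff_transform_contracted (fun i => algebraMap A A' ((![x, g] : Fin 2 → A) i)) ![r, q]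
    (algebraMap A' (Localization.AtPrime (𝔭.map (algebraMap A A')))) hfg hnotmem
  -- `V(U') ⊆ V(P')` on `Spec A'` (the pair clause on `D(h)`)
  have hVU : ∀ 𝔮' : Ideal A', 𝔮'.IsPrime →
      Ideal.span (Set.range fun i => algebraMap A A' ((![x, g] : Fin 2 → A) i)) ≤ 𝔮' → 𝔭.map (algebraMap A A') ≤ 𝔮' := by
    intro 𝔮' h𝔮' hUle
    haveI := h𝔮'
    have hs𝔮 : h * s₁ ∉ 𝔮'.comap (algebraMap A A') := not_mem_comap_of_away (h * s₁) 𝔮'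
    have hh𝔮 : h ∉ 𝔮'.comap (algebraMap A A') := fun hh => hs𝔮 (Ideal.mul_mem_right _ _ hh)
    have hx𝔮 : x ∈ 𝔮'.comap (algebraMap A A') := hUle (Ideal.subset_span ⟨0, rfl⟩)
    have hg𝔮 : g ∈ 𝔮'.comap (algebraMap A A') := hUle (Ideal.subset_span ⟨1, rfl⟩)
    exact Ideal.map_le_iff_le_comap.mpr (Hpair _ hh𝔮 hx𝔮 hg𝔮).1
  exact finite_tiePrimes' (𝔭.map (algebraMap A A')) hdimP' hn hord' (fun i => algebraMap A A' ((![x, g] : Fin 2 → A) i))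
    hUP hlex' hfg hG hcontr hF hWP hWc hVU

end Chart

end TieFinite

end Summit.ResolutionOfSingularities.ResolutionOfSingularities.Cruxes.HypersurfaceCentreConstruction.LocalEngine

end
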